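import Summits.PneNP.PneNP.Theorems.KarlinRubinMonotoneSufficesRoomCount
import Literature.Probability.RandomGraphs.PlantedClique

/-!
# Crux `MonotoneSuffices` (stmt-PneNP-18026), the ROOM theorem — part 2:
# stars in `Kₙ`, common-neighbourhood counts, and the two per-`n` error counts of the detector

The guess-and-verify detector accepts an edge vector `x ∈ {0,1}^{E(Kₙ)}` iff SOME `t`-set `T` of vertices
has at least `θ` common neighbours outside `T`:
`D x = [∃ T, #T = t, θ ≤ #{u ∉ T : x ≡ 1 on star T u}]`, `star T u = {s(u,w) : w ∈ T}`.
For `u ∉ T` the stars are pairwise disjoint `t`-sets of edges (`card_star`, `pairwiseDisjoint_star`), so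
part 1 applies: under `G(n,1/2)` (uniform `x`) the count is `Bin(n - t, 2^{-t})` and

* `card_null_le` — `#{x : D x = 1} ≤ C(n,t) · 2^{#E} · exp(-η² μ / 4)` whenever `(1+η) μ ≤ θ`,
  `μ = (n-t) 2^{-t}`, `0 ≤ η ≤ 2` (union bound over `T` + Chernoff upper tail);
* `card_planted_le` — for a planted set `A ⊇ T₀`, `#T₀ = t`: `#{z : D (plant A z) = 0} ≤ 2^{#E} exp(-η² μ₁/4)`
  whenever `θ - (#A - t) - 1 ≤ (1-η) μ₁`, `μ₁ = (n - #A) 2^{-t}`: the vertices of `A ∖ T₀` are common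
  neighbours of `T₀` for free and those outside `A` see only noise edges (`cnt_plant_ge`), Chernoff lower tail.

Counting only; the circuit and the parameter choice are parts 3–4.
-/

set_option linter.dupNamespace false -- `Summit.PneNP.PneNP.…`: summit = sub-problem name (D-0017 single-conjunct layout)

namespace Summit.PneNP.PneNP.Theorems.MonotoneSuffices.Room

open Finset Real
open Literature.Probability.RandomGraphs.PlantedClique

variable {n : ℕ}

/-! ### Stars -/

/-- The star of `u` towards `T` (`u ∉ T`) has exactly `#T` edges. [folklore] -/
theorem card_star (T : Finset (Fin n)) {u : Fin n} (hu : u ∉ T) :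
    #(univ.filter fun e : (⊤ : SimpleGraph (Fin n)).edgeSet => ∃ w ∈ T, (e : Sym2 (Fin n)) = s(u, w)) = #T := by
  classical
  have hne : ∀ w ∈ T, u ≠ w := fun w hw h => hu (h ▸ hw)
  have himg : (univ.filter fun e : (⊤ : SimpleGraph (Fin n)).edgeSet => ∃ w ∈ T, (e : Sym2 (Fin n)) = s(u, w)) =
      T.attach.image fun w => (⟨s(u, w.1), (SimpleGraph.mem_edgeSet ⊤).2
        ((SimpleGraph.top_adj u w.1).2 (hne w.1 w.2))⟩ : (⊤ : SimpleGraph (Fin n)).edgeSet) := by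
    ext ⟨e, he⟩
    simp only [mem_filter, mem_univ, true_and, mem_image, mem_attach, Subtype.mk.injEq]
    constructor
    · rintro ⟨w, hw, hew⟩
      exact ⟨⟨w, hw⟩, hew.symm⟩
    · rintro ⟨⟨w, hw⟩, h⟩
      exact ⟨w, hw, h.symm⟩
  rw [himg, card_image_of_injective _ ?_, card_attach]
  intro a b hab
  have h := congrArg Subtype.val hab
  exact Subtype.ext (Sym2.congr_right.1 h)

/-- Stars of distinct vertices outside `T` are disjoint. [folklore] -/
theorem pairwiseDisjoint_star (T U : Finset (Fin n)) (hUT : ∀ u ∈ U, u ∉ T) :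
    (U : Set (Fin n)).PairwiseDisjoint fun u =>
      univ.filter fun e : (⊤ : SimpleGraph (Fin n)).edgeSet => ∃ w ∈ T, (e : Sym2 (Fin n)) = s(u, w) := by
  intro u hu u' hu' huu'
  simp only [Function.onFun, disjoint_filter, mem_univ, true_imp_iff]
  rintro e ⟨w, hw, hew⟩ ⟨w', hw', hew'⟩
  rw [hew] at hew'
  rcases Sym2.eq_iff.1 hew' with ⟨h1, -⟩ | ⟨h1, -⟩
  · exact huu' h1
  · exact hUT u hu (h1 ▸ hw')

/-! ### The null count: union bound over `T` and the Chernoff upper tail -/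

/-- Chernoff upper tail for the number of common neighbours of `T` in `U` (`U ∩ T = ∅`) under the
uniform law: `#{x : (1+η) #U 2^{-#T} ≤ cnt} ≤ 2^{#E} exp(-η² #U 2^{-#T} / 4)`. [folklore] -/
theorem card_cnt_ge_le (T U : Finset (Fin n)) (hUT : ∀ u ∈ U, u ∉ T) {η : ℝ} (hη : 0 ≤ η) (hη2 : η ≤ 2) :
    (#(univ.filter fun x : EdgeVec n => (1 + η) * (#U * (2 : ℝ)⁻¹ ^ #T) ≤
        (#(U.filter fun u => ∀ e ∈ (univ.filter fun e : (⊤ : SimpleGraph (Fin n)).edgeSet =>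
          ∃ w ∈ T, (e : Sym2 (Fin n)) = s(u, w)), x e = true) : ℝ)) : ℝ) ≤
      2 ^ Fintype.card (⊤ : SimpleGraph (Fin n)).edgeSet * Real.exp (-(η ^ 2 * (#U * (2 : ℝ)⁻¹ ^ #T) / 4)) := by
  classical
  exact card_filter_ge_cnt_le_exp (E := (⊤ : SimpleGraph (Fin n)).edgeSet) U
    (fun u => univ.filter fun e : (⊤ : SimpleGraph (Fin n)).edgeSet => ∃ w ∈ T, (e : Sym2 (Fin n)) = s(u, w)) (#T)
    (fun u hu => card_star T (hUT u hu)) (pairwiseDisjoint_star T U hUT) hη hη2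

/-- **Null count of the detector.** If `(1+η) (n-t) 2^{-t} ≤ θ` with `0 ≤ η ≤ 2`, then
`#{x : ∃ T, #T = t, θ ≤ cnt_T x} ≤ C(n,t) · 2^{#E} · exp(-η² (n-t) 2^{-t} / 4)`. [folklore] -/
theorem card_null_le (t θ : ℕ) {η : ℝ} (hη : 0 ≤ η) (hη2 : η ≤ 2)
    (hθ : (1 + η) * (((n - t : ℕ) : ℝ) * (2 : ℝ)⁻¹ ^ t) ≤ θ) :
    (#(univ.filter fun x : EdgeVec n => ∃ T ∈ powersetCard t (univ : Finset (Fin n)),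
        θ ≤ #((univ \ T).filter fun u => ∀ e ∈ (univ.filter fun e : (⊤ : SimpleGraph (Fin n)).edgeSet =>
          ∃ w ∈ T, (e : Sym2 (Fin n)) = s(u, w)), x e = true)) : ℝ) ≤
      (n.choose t : ℝ) * (2 ^ Fintype.card (⊤ : SimpleGraph (Fin n)).edgeSet *
        Real.exp (-(η ^ 2 * (((n - t : ℕ) : ℝ) * (2 : ℝ)⁻¹ ^ t) / 4))) := by
  classical
  -- union bound
  have hsub : (univ.filter fun x : EdgeVec n => ∃ T ∈ powersetCard t (univ : Finset (Fin n)),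
      θ ≤ #((univ \ T).filter fun u => ∀ e ∈ (univ.filter fun e : (⊤ : SimpleGraph (Fin n)).edgeSet =>
        ∃ w ∈ T, (e : Sym2 (Fin n)) = s(u, w)), x e = true)) =
      (powersetCard t (univ : Finset (Fin n))).biUnion fun T => univ.filter fun x : EdgeVec n =>
        θ ≤ #((univ \ T).filter fun u => ∀ e ∈ (univ.filter fun e : (⊤ : SimpleGraph (Fin n)).edgeSet =>
          ∃ w ∈ T, (e : Sym2 (Fin n)) = s(u, w)), x e = true) := by
    ext x
    simp only [mem_filter, mem_univ, true_and, mem_biUnion]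
  rw [hsub]
  refine (Nat.cast_le.2 card_biUnion_le).trans ?_
  push_cast
  have hT : ∀ T ∈ powersetCard t (univ : Finset (Fin n)),
      (#(univ.filter fun x : EdgeVec n =>
        θ ≤ #((univ \ T).filter fun u => ∀ e ∈ (univ.filter fun e : (⊤ : SimpleGraph (Fin n)).edgeSet =>
          ∃ w ∈ T, (e : Sym2 (Fin n)) = s(u, w)), x e = true)) : ℝ) ≤
      2 ^ Fintype.card (⊤ : SimpleGraph (Fin n)).edgeSet *
        Real.exp (-(η ^ 2 * (((n - t : ℕ) : ℝ) * (2 : ℝ)⁻¹ ^ t) / 4)) := by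
    intro T hT
    have hTc : #T = t := (mem_powersetCard.1 hT).2
    have hUc : #(univ \ T) = n - t := by rw [card_univ_sdiff, Fintype.card_fin, hTc]
    have h := card_cnt_ge_le T (univ \ T) (fun u hu => (mem_sdiff.1 hu).2) hη hη2
    rw [hTc, hUc] at h
    refine le_trans ?_ h
    exact_mod_cast card_le_card fun x hx => by
      simp only [mem_filter, mem_univ, true_and] at hx ⊢
      exact hθ.trans (by exact_mod_cast hx)
  refine (sum_le_sum hT).trans ?_
  rw [sum_const, card_powersetCard, card_univ, Fintype.card_fin, nsmul_eq_mul]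

/-! ### The planted count -/

/-- Planting switches every edge inside `A` on and leaves the other edges unchanged. [folklore] -/
theorem plant_apply_eq (A : Finset (Fin n)) (x : EdgeVec n) (e : (⊤ : SimpleGraph (Fin n)).edgeSet) :
    plant A x e = (x e || decide (∀ v ∈ (e : Sym2 (Fin n)), v ∈ A)) := by
  classical
  simp [plant]

/-- **Common neighbours after planting.** For `T₀ ⊆ A` and any `z`, the common neighbours of `T₀` in
`plant A z` outside `T₀` include all of `A ∖ T₀` and every common neighbour of `T₀` in `z` outside `A`:
`#(A ∖ T₀) + cnt_{T₀, univ ∖ A}(z) ≤ cnt_{T₀, univ ∖ T₀}(plant A z)`. [folklore] -/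
theorem cnt_plant_ge (A T₀ : Finset (Fin n)) (hT₀ : T₀ ⊆ A) (z : EdgeVec n) :
    #(A \ T₀) + #((univ \ A).filter fun u => ∀ e ∈ (univ.filter fun e : (⊤ : SimpleGraph (Fin n)).edgeSet =>
        ∃ w ∈ T₀, (e : Sym2 (Fin n)) = s(u, w)), z e = true) ≤
      #((univ \ T₀).filter fun u => ∀ e ∈ (univ.filter fun e : (⊤ : SimpleGraph (Fin n)).edgeSet =>
        ∃ w ∈ T₀, (e : Sym2 (Fin n)) = s(u, w)), plant A z e = true) := by
  classical
  -- inside `A`: every star edge is planted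
  have hin : ∀ u ∈ A \ T₀, ∀ e ∈ (univ.filter fun e : (⊤ : SimpleGraph (Fin n)).edgeSet =>
      ∃ w ∈ T₀, (e : Sym2 (Fin n)) = s(u, w)), plant A z e = true := by
    intro u hu e he
    obtain ⟨w, hw, hew⟩ := (mem_filter.1 he).2
    rw [plant_apply_eq, Bool.or_eq_true]
    refine Or.inr (decide_eq_true fun v hv => ?_)
    rw [hew, Sym2.mem_iff] at hv
    rcases hv with rfl | rfl
    · exact (mem_sdiff.1 hu).1
    · exact hT₀ hw
  -- outside `A`: planting does not touch the star edges
  have hout : ∀ u ∈ univ \ A, ∀ e ∈ (univ.filter fun e : (⊤ : SimpleGraph (Fin n)).edgeSet =>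
      ∃ w ∈ T₀, (e : Sym2 (Fin n)) = s(u, w)), plant A z e = z e := by
    intro u hu e he
    obtain ⟨w, hw, hew⟩ := (mem_filter.1 he).2
    have hnot : ¬ ∀ v ∈ (e : Sym2 (Fin n)), v ∈ A := fun h =>
      (mem_sdiff.1 hu).2 (h u (by rw [hew]; exact Sym2.mem_mk_left u w))
    rw [plant_apply_eq, decide_eq_false hnot, Bool.or_false]
  have hdisj : Disjoint (A \ T₀) ((univ \ A).filter fun u => ∀ e ∈ (univ.filter fun e : (⊤ : SimpleGraph (Fin n)).edgeSet =>
      ∃ w ∈ T₀, (e : Sym2 (Fin n)) = s(u, w)), z e = true) := by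
    rw [disjoint_left]
    intro u hu hu'
    exact (mem_sdiff.1 (mem_filter.1 hu').1).2 (mem_sdiff.1 hu).1
  rw [← card_union_of_disjoint hdisj]
  refine card_le_card fun u hu => ?_
  rw [mem_union] at hu
  rw [mem_filter]
  rcases hu with hu | hu
  · exact ⟨mem_sdiff.2 ⟨mem_univ _, (mem_sdiff.1 hu).2⟩, hin u hu⟩
  · obtain ⟨hu1, hu2⟩ := mem_filter.1 hu
    refine ⟨mem_sdiff.2 ⟨mem_univ _, fun h => (mem_sdiff.1 hu1).2 (hT₀ h)⟩, fun e he => ?_⟩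
    rw [hout u hu1 e he]
    exact hu2 e he

/-- **Planted count of the detector, for one planted set.** Let `T₀ ⊆ A` with `#T₀ = t`, `0 ≤ η ≤ 2` and
`θ - (#A - t) - 1 ≤ (1-η) (n - #A) 2^{-t}`. Then the inputs `z` whose planted version `plant A z` is
REJECTED by the detector number at most `2^{#E} exp(-η² (n - #A) 2^{-t} / 4)`. [folklore] -/
theorem card_planted_le (A T₀ : Finset (Fin n)) (hT₀ : T₀ ⊆ A) (t θ : ℕ) (ht : #T₀ = t)
    {η : ℝ} (hη : 0 ≤ η) (hη2 : η ≤ 2)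
    (hθ : (θ : ℝ) - ((#A - t : ℕ) : ℝ) - 1 ≤ (1 - η) * (((n - #A : ℕ) : ℝ) * (2 : ℝ)⁻¹ ^ t)) :
    (#(univ.filter fun z : EdgeVec n => ¬ ∃ T ∈ powersetCard t (univ : Finset (Fin n)),
        θ ≤ #((univ \ T).filter fun u => ∀ e ∈ (univ.filter fun e : (⊤ : SimpleGraph (Fin n)).edgeSet =>
          ∃ w ∈ T, (e : Sym2 (Fin n)) = s(u, w)), plant A z e = true)) : ℝ) ≤
      2 ^ Fintype.card (⊤ : SimpleGraph (Fin n)).edgeSet *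
        Real.exp (-(η ^ 2 * (((n - #A : ℕ) : ℝ) * (2 : ℝ)⁻¹ ^ t) / 4)) := by
  classical
  have hU : ∀ u ∈ univ \ A, u ∉ T₀ := fun u hu h => (mem_sdiff.1 hu).2 (hT₀ h)
  have h := card_filter_cnt_le_le_exp (E := (⊤ : SimpleGraph (Fin n)).edgeSet) (univ \ A)
    (fun u => univ.filter fun e : (⊤ : SimpleGraph (Fin n)).edgeSet => ∃ w ∈ T₀, (e : Sym2 (Fin n)) = s(u, w)) t
    (fun u hu => (card_star T₀ (hU u hu)).trans ht) (pairwiseDisjoint_star T₀ (univ \ A) hU) hη hη2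
  have hUc : #(univ \ A) = n - #A := by rw [card_univ_sdiff, Fintype.card_fin]
  rw [hUc] at h
  refine le_trans ?_ h
  have hT₀mem : T₀ ∈ powersetCard t (univ : Finset (Fin n)) := mem_powersetCard.2 ⟨subset_univ _, ht⟩
  exact_mod_cast card_le_card fun z hz => by
    rw [mem_filter] at hz ⊢
    refine ⟨mem_univ _, ?_⟩
    obtain ⟨-, hz⟩ := hz
    have hlt : ¬ θ ≤ #((univ \ T₀).filter fun u => ∀ e ∈ (univ.filter fun e : (⊤ : SimpleGraph (Fin n)).edgeSet =>
        ∃ w ∈ T₀, (e : Sym2 (Fin n)) = s(u, w)), plant A z e = true) := fun h => hz ⟨T₀, hT₀mem, h⟩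
    have hge := cnt_plant_ge A T₀ hT₀ z
    rw [card_sdiff_of_subset hT₀, ht] at hge
    have hnat : #((univ \ A).filter fun u => ∀ e ∈ (univ.filter fun e : (⊤ : SimpleGraph (Fin n)).edgeSet =>
        ∃ w ∈ T₀, (e : Sym2 (Fin n)) = s(u, w)), z e = true) + (#A - t) + 1 ≤ θ := by omega
    have hreal : (#((univ \ A).filter fun u => ∀ e ∈ (univ.filter fun e : (⊤ : SimpleGraph (Fin n)).edgeSet =>
        ∃ w ∈ T₀, (e : Sym2 (Fin n)) = s(u, w)), z e = true) : ℝ) + ((#A - t : ℕ) : ℝ) + 1 ≤ θ := by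
      exact_mod_cast hnat
    linarith

end Summit.PneNP.PneNP.Theorems.MonotoneSuffices.Room


namespace Summit.PneNP.PneNP.Theorems.MonotoneSuffices.Room

open Finset

/-- Registered sub-goal `room_null` of stmt-PneNP-18026 (room theorem, part 2): the null count of the
guess-and-verify detector, exported verbatim. [folklore] -/
theorem room_null :
    ∀ {n : ℕ} (t θ : ℕ) {η : ℝ}, 0 ≤ η → η ≤ 2 → (1 + η) * (((n - t : ℕ) : ℝ) * (2 : ℝ)⁻¹ ^ t) ≤ θ → (#((Finset.univ : Finset (Literature.Probability.RandomGraphs.PlantedClique.EdgeVec n)).filter fun x => ∃ T ∈ Finset.powersetCard t (Finset.univ : Finset (Fin n)), θ ≤ #((Finset.univ \ T).filter fun u => ∀ e ∈ (Finset.univ.filter fun e : (⊤ : SimpleGraph (Fin n)).edgeSet => ∃ w ∈ T, (e : Sym2 (Fin n)) = s(u, w)), x e = true)) : ℝ) ≤ (n.choose t : ℝ) * (2 ^ Fintype.card (⊤ : SimpleGraph (Fin n)).edgeSet * Real.exp (-(η ^ 2 * (((n - t : ℕ) : ℝ) * (2 : ℝ)⁻¹ ^ t) / 4))) :=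
  fun t θ _ hη hη2 hθ => card_null_le t θ hη hη2 hθ

end Summit.PneNP.PneNP.Theorems.MonotoneSuffices.Room
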